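import Mathlib
import HarnessLib
import HarnessLib.Audit
import Summits.AtomisticToContinuum.Crystallization.Statement
import Summits.AtomisticToContinuum.Crystallization.Theses.GrandCanonicalSelection

/-!
# Crux `MuGSCSolidBalls` (stmt-AtomisticToContinuum-13682) — birth skeleton (BC3)

Route `GrandCanonicalSelection` (sub-problem `Crystallization`), crux rank 3:

  for `e = lim E(N)/N` there is `r₁ > 0` such that every non-empty uniformly discrete `μ`GSC `X`
  of Lennard-Jones at the coexistence potential `μ = e` contains, for every `R'`, a ball of
  radius `R'` each point of which lies within `r₁` of `X` ("coexistence `μ`GSCs are solid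
  somewhere at every scale: no foams, no sponges").

## The line — KOSSEL EVAPORATION AT COEXISTENCE + FØLNER SHELLS (three named stubs)

Suppose `X` is porous at scale `(r₁, R')` EVERYWHERE (every ball of radius `R'` contains a point
at distance `> r₁` from `X`). For a window `W = X ∩ B̄_R(c)` the REMOVAL TEST of a `μ`GSC at
`μ = e` (`IsMuGSC.removal`, in tree) reads `U(W) + I(W, X ∖ W) ≤ e · #W`: no finite chunk is bound
by less than `|e|` per particle, else evaporating it lowers `U − e·#` (Kossel–Stranski at the
coexistence value `μ = e* = inf_N E(N)/N`, where bulk terms cancel exactly). Three independent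
mechanisms then collide:

* `stub_porosityGap` — POROSITY COSTS VOLUME (the load-bearing, open content; finite clusters
  only, no `μ`GSC, no infinite configuration): there is a hole radius `r₁ > 0` such that for
  every porosity scale `R' > 0` some `η = η(R') > 0` has `U(x) ≥ (e + η) · n` for EVERY injective
  `n`-point configuration `x` that is `(r₁, R')`-porous everywhere. The atomistic counterpart of
  "perimeter almost-minimisers are porous at no scale": each `r₁`-cavity carved into matter at
  coexistence costs hole-surface energy `≳ σ r₁²`, and an everywhere-porous cluster carries
  `≳ n / R'³` cavities; uniformly in `n` this is positive surface tension of Lennard-Jones matter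
  (small `n` is covered by `E(n) > n e`, strict for every finite `n` by the attractive tail).
* `stub_cutCostShell` — THE CUT COST IS A BOUNDARY TERM (provable now; `r⁻⁶` shell sums over a
  uniformly discrete set): for `X` uniformly discrete and every `ε > 0` there are `C, T > 0` with
  `I(W, X ∖ W) ≥ −(C · #{w ∈ W : R − T < |w − c|} + ε · #W)` for every window
  `W = X ∩ B̄_R(c)`: particles deeper than `T` inside the ball see the exterior only through the
  `T⁻³` tail, shell particles through at most `C = C(δ)` each (`V_LJ ≥ −t⁻⁶/6`, shell counting as
  in `UniformlyDiscrete.summable_of_abs_le_inv_pow_six`).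
* `stub_thinShell` — FØLNER BALLS IN SETS OF POLYNOMIAL GROWTH (provable now; packing): for `X`
  uniformly discrete, `x₀ ∈ X`, and every `κ, T > 0` some ball `B̄_R(x₀)`, `R ≥ 0`, has at most a
  fraction `κ` of its points in the outer shell of width `T`: otherwise
  `#(X ∩ B̄_{R−T}) < (1 − κ) · #(X ∩ B̄_R)` for all `R` forces exponential growth of
  `R ↦ #(X ∩ B̄_R(x₀)) ≥ 1`, against the cubic packing bound `(2R/δ + 1)³`.
* `MuGSCSolidBalls_of` — the kernel-checked composition (real proof, no `sorry`), type literally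
  `stub₁-sig → stub₂-sig → stub₃-sig → GrandCanonicalSelection.MuGSCSolidBalls`: take `r₁` from the
  porosity gap; given a non-empty uniformly discrete `μ`GSC `X ∋ x₀` at `e` and a radius `R'`
  (`R' ≤ 0` is settled by the centre `x₀` itself), assume every `R'`-ball has an `r₁`-hole; with
  `η = η(R')`, `ε := η/4` in the cut cost (constants `C, T`) and `κ := η/(4C)` in the Følner
  stub, the thin-shelled window `W = X ∩ B̄_R(x₀)` (`#W ≥ 1`) satisfies
  `(e + η)·#W − (η/4)·#W − (η/4)·#W ≤ U(W) + I(W, X ∖ W) ≤ e·#W` — porosity gap + cut cost against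
  the removal test — i.e. `(η/2)·#W ≤ 0`, absurd.
* `MuGSCSolidBalls_skeleton` / `MuGSCSolidBalls_proof : GrandCanonicalSelection.MuGSCSolidBalls`
  — the crux BY NAME from the three stubs (the only `sorry`s in its cone are the three `stub_*`).

`sorry` occurs ONLY inside the three `stub_*` theorems. No stub is the crux or the sub-problem in
disguise: stub 1 speaks of finite injective configurations only, stubs 2–3 of arbitrary uniformly
discrete sets (no potential in stub 3, no `μ`GSC anywhere); BC3 probes `stub → MuGSCSolidBalls`
and `stub → Crystallization` by `first | exact? | simpa | aesop` all FAIL (see `Lines/birth.md`).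
Which `H` of the crux each stub spends: `IsMuGSC` enters ONLY through the removal test in `_of`
(insertions are never used — the line proves the formally stronger "evaporation-stable ⇒ solid
balls"); `UniformlyDiscrete` feeds stubs 2–3; `X.Nonempty` gives the centre `x₀` (the vacuum is a
`μ`GSC at the same `μ`, so non-emptiness is essential); `Tendsto … (nhds e)` pins `e = e*` inside
stub 1 (with `e` above `e*` the porosity gap would be false for large `R'` — near-optimal crystals with sparse
cavities have excess only `≳ n / R'³` — and with `e` below `e*` it would be a weaker statement).

Disproof used: none on file for this crux at registration (no `Cruxes/MuGSCSolidBalls/` directory,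
no `Disproof.lean`, no Negative lemmas, no dead lines). Negatives of the sub-problem are
finite-configuration rigidity / counting statements (local Hales at 1 %, gapped twelve-shell
census, one-grain gluing, one-multiplier pricing); none is an instance of the three stubs.
-/

namespace Summit.AtomisticToContinuum.Crystallization.Cruxes.MuGSCSolidBalls.Birth

open Filter

/-! ## The stubs -/

/-- **Stub 1 — POROSITY GAP for finite clusters (load-bearing).** For the thermodynamic limit
`e = lim E(N)/N` of Lennard-Jones in `ℝ³` there is a hole radius `r₁ > 0` such that for every
porosity scale `R' > 0` some `η > 0` satisfies: every injective configuration `x` of `n` points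
that is `(r₁, R')`-POROUS EVERYWHERE — every point `c` of space has, within distance `R'`, a point
`z` at distance `> r₁` from all particles — has energy `U(x) ≥ (e + η) · n`. Why plausibly true:
`U(x) − e·n` is the excess over bulk at coexistence; an everywhere-porous cluster has `≳ n / R'³`
cavities of radius `r₁` next to matter, each costing hole-surface energy `≳ σ r₁²` (positive
surface tension of LJ matter; `r₁` above the covering radius of the close packing so that the
perfect crystal is not porous), and for `n ≲ R'³` the bound is `E(n) > n·e` (strict: two far
copies of an `n`-cluster attaining `n·e` would give `E(2n) < 2n·e`). Fails iff some family of
everywhere-porous LJ clusters (facetted labyrinths, Schwarz-P-like frameworks with few-layer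
walls) has excess `o(n)` — i.e. iff carving cavities is asymptotically free, the "no off-lattice
`σ > 0` in 3-D" risk recorded on the crux. Size XL (contains uniform positivity of the LJ surface
energy for porous clusters); the natural children are HOLE PRICING (each particle adjacent to an
`r₁`-cavity carries excess `≥ η₀`, a local finite-configuration inequality) and HOLE COUNTING
(in an everywhere-porous separated cluster a fixed fraction `≥ 1/M(R')` of the particles is
cavity-adjacent — walk from a particle towards its nearest hole). Leans on: `interactionEnergy`,
`groundStateEnergy`, `BlancLewin2015_8_holds` (`e = inf_N E(N)/N`), `groundStateEnergy_lennardJones_le`. -/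
theorem stub_porosityGap : ∀ e : ℝ, Filter.Tendsto (fun N : ℕ => Literature.MathematicalPhysics.StatisticalMechanics.groundStateEnergy Literature.MathematicalPhysics.StatisticalMechanics.lennardJones 3 N / N) Filter.atTop (nhds e) → ∃ r₁ : ℝ, 0 < r₁ ∧ ∀ R' : ℝ, 0 < R' → ∃ η : ℝ, 0 < η ∧ ∀ (n : ℕ) (x : Fin n → EuclideanSpace ℝ (Fin 3)), Function.Injective x → (∀ c : EuclideanSpace ℝ (Fin 3), ∃ z : EuclideanSpace ℝ (Fin 3), dist z c ≤ R' ∧ ∀ i : Fin n, r₁ < dist (x i) z) → (e + η) * n ≤ Literature.MathematicalPhysics.StatisticalMechanics.interactionEnergy Literature.MathematicalPhysics.StatisticalMechanics.lennardJones x := by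
  sorry

/-- **Stub 2 — THE CUT COST IS A BOUNDARY TERM.** For a uniformly discrete `X ⊆ ℝ³` and every
`ε > 0` there are `C > 0` and a shell width `T > 0` such that for every window `W = X ∩ B̄_R(c)`
(enumerated injectively by `xf`) the interaction of `W` with the rest of `X` is
`I(W, X ∖ W) ≥ −(C · #{i : R − T < |xf i − c|} + ε · #W)`. Why plausibly true (provable now):
`V_LJ(t) ≥ −t⁻⁶/6`; a particle of `W` deeper than `T` inside the ball is at distance `> T` from
every point of `X ∖ W ⊆ ℝ³ ∖ B̄_R(c)`, and `∑_{y ∈ X, |y − w| ≥ T} |w − y|⁻⁶ ≤ C_δ T⁻³` by shell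
counting over a `δ`-separated set (choose `T` with `C_δ T⁻³ ≤ 6ε`); a shell particle sees at most
`∑_{y ∈ X, y ≠ w} |w − y|⁻⁶ ≤ 250 δ⁻⁶` (`sum_inv_pow_six_le_of_le_dist`). The field sums are
genuine (`UniformlyDiscrete.summable_lennardJones`, `.mono`). Size M. Leans on: `fieldEnergy`,
`UniformlyDiscrete.summable_of_abs_le_inv_pow_six`, `sum_inv_pow_six_le_of_le_dist`,
`abs_lennardJones_le`, `UniformlyDiscrete.finite_inter_closedBall`. -/
theorem stub_cutCostShell : ∀ X : Set (EuclideanSpace ℝ (Fin 3)), Literature.MathematicalPhysics.StatisticalMechanics.UniformlyDiscrete X → ∀ ε : ℝ, 0 < ε → ∃ C : ℝ, 0 < C ∧ ∃ T : ℝ, 0 < T ∧ ∀ (c : EuclideanSpace ℝ (Fin 3)) (R : ℝ) (n : ℕ) (xf : Fin n → EuclideanSpace ℝ (Fin 3)), Function.Injective xf → Set.range xf = X ∩ Metric.closedBall c R → -(C * ((Finset.univ.filter fun i : Fin n => R - T < dist (xf i) c).card : ℝ) + ε * n) ≤ Literature.MathematicalPhysics.StatisticalMechanics.fieldEnergy Literature.MathematicalPhysics.StatisticalMechanics.lennardJones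 xf (X \ Set.range xf) := by
  sorry

/-- **Stub 3 — FØLNER BALLS (thin shells) in uniformly discrete sets.** For a uniformly discrete
`X ⊆ ℝ³`, a point `x₀ ∈ X` and every `κ > 0`, `T > 0` there is a radius `R ≥ 0` such that the
window `X ∩ B̄_R(x₀)` (enumerated injectively by `xf`, so `#W ≥ 1`) has at most `κ · #W` points in
its outer shell `{R − T < |· − x₀|}`. Why plausibly true (provable now): if every ball failed,
`#(X ∩ B̄_{R−T}(x₀)) < (1 − κ) · #(X ∩ B̄_R(x₀))` for all `R ≥ 0`, so
`#(X ∩ B̄_{kT}(x₀)) > (1 − κ)^{−k}` — exponential growth, against the packing bound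
`#(X ∩ B̄_R) ≤ (2R/δ + 1)³` (`card_le_of_separated_of_dist_le`). Size M. Leans on:
`UniformlyDiscrete.finite_inter_closedBall`, `Set.Finite.fin_embedding`,
`card_le_of_separated_of_dist_le`, `one_add_mul_le_pow` / `pow_unbounded_of_one_lt`. -/
theorem stub_thinShell : ∀ X : Set (EuclideanSpace ℝ (Fin 3)), Literature.MathematicalPhysics.StatisticalMechanics.UniformlyDiscrete X → ∀ x₀ ∈ X, ∀ κ : ℝ, 0 < κ → ∀ T : ℝ, 0 < T → ∃ R : ℝ, 0 ≤ R ∧ ∃ (n : ℕ) (xf : Fin n → EuclideanSpace ℝ (Fin 3)), Function.Injective xf ∧ Set.range xf = X ∩ Metric.closedBall x₀ R ∧ ((Finset.univ.filter fun i : Fin n => R - T < dist (xf i) x₀).card : ℝ) ≤ κ * n := by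
  sorry

/-! ## The composition (kernel-checked, no sorry) -/

/-- **Composition** `stub₁-sig → stub₂-sig → stub₃-sig → GrandCanonicalSelection.MuGSCSolidBalls`
(the crux BY NAME), real proof: Kossel evaporation at coexistence. With `r₁` from the porosity
gap, if a non-empty uniformly discrete `μ`GSC `X ∋ x₀` at `e` had an `r₁`-hole in every `R'`-ball
(`R' > 0`; `R' ≤ 0` is settled by `x₀`), then on a thin-shelled window `W = X ∩ B̄_R(x₀)` (stub 3
with `κ = η/(4C)`) the porosity gap (stub 1, `W` inherits the holes of `X`) and the cut cost
(stub 2 with `ε = η/4`) give `(e + η/2)·#W ≤ U(W) + I(W, X ∖ W)`, while the removal test of the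
`μ`GSC gives `U(W) + I(W, X ∖ W) ≤ e·#W`; as `#W ≥ 1`, contradiction. -/
theorem MuGSCSolidBalls_of : (∀ e : ℝ, Filter.Tendsto (fun N : ℕ => Literature.MathematicalPhysics.StatisticalMechanics.groundStateEnergy Literature.MathematicalPhysics.StatisticalMechanics.lennardJones 3 N / N) Filter.atTop (nhds e) → ∃ r₁ : ℝ, 0 < r₁ ∧ ∀ R' : ℝ, 0 < R' → ∃ η : ℝ, 0 < η ∧ ∀ (n : ℕ) (x : Fin n → EuclideanSpace ℝ (Fin 3)), Function.Injective x → (∀ c : EuclideanSpace ℝ (Fin 3), ∃ z : EuclideanSpace ℝ (Fin 3), dist z c ≤ R' ∧ ∀ i : Fin n, r₁ < dist (x i) z) → (e + η) * n ≤ Literature.MathematicalPhysics.StatisticalMechanics.interactionEnergy Literature.MathematicalPhysics.StatisticalMechanics.lennardJones x) → (∀ X : Set (EuclideanSpace ℝ (Fin 3)), Literature.MathematicalPhysics.StatisticalMechanics.UniformlyDiscrete X → ∀ ε : ℝ, 0 < ε → ∃ C : ℝ, 0 < C ∧ ∃ T : ℝ, 0 < T ∧ ∀ (c : EuclideanSpace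 ℝ (Fin 3)) (R : ℝ) (n : ℕ) (xf : Fin n → EuclideanSpace ℝ (Fin 3)), Function.Injective xf → Set.range xf = X ∩ Metric.closedBall c R → -(C * ((Finset.univ.filter fun i : Fin n => R - T < dist (xf i) c).card : ℝ) + ε * n) ≤ Literature.MathematicalPhysics.StatisticalMechanics.fieldEnergy Literature.MathematicalPhysics.StatisticalMechanics.lennardJones xf (X \ Set.range xf)) → (∀ X : Set (EuclideanSpace ℝ (Fin 3)), Literature.MathematicalPhysics.StatisticalMechanics.UniformlyDiscrete X → ∀ x₀ ∈ X, ∀ κ : ℝ, 0 < κ → ∀ T : ℝ, 0 < T → ∃ R : ℝ, 0 ≤ R ∧ ∃ (n : ℕ) (xf : Fin n → EuclideanSpace ℝ (Fin 3)), Function.Injective xf ∧ Set.range xf = X ∩ Metric.closedBall x₀ R ∧ ((Finset.univ.filter fun i : Fin n => R - T < dist (xf i) x₀).card : ℝ) ≤ κ * n) → Summit.AtomisticToContinuum.Crystallization.Theses.GrandCanonicalSelection.MuGSCSolidBalls := by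
  intro hGap hCut hShell e he
  obtain ⟨r₁, hr₁, hgap⟩ := hGap e he
  refine ⟨r₁, hr₁, fun X hne hUD hGSC R' => ?_⟩
  obtain ⟨x₀, hx₀⟩ := hne
  rcases le_or_gt R' 0 with hR' | hR'
  · -- degenerate radius: the ball of radius `R' ≤ 0` about `x₀ ∈ X` is at most `{x₀}`
    refine ⟨x₀, fun z hz => ⟨x₀, hx₀, ?_⟩⟩
    have h0 : dist z x₀ = 0 := le_antisymm (hz.trans hR') dist_nonneg
    rw [dist_comm, h0]
    exact hr₁.le
  · -- Kossel evaporation: an everywhere-porous coexistence μGSC has a chunk bound by less than |e|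
    by_contra hcon
    push Not at hcon
    -- hcon : ∀ c, ∃ z, dist z c ≤ R' ∧ ∀ x ∈ X, r₁ < dist x z
    obtain ⟨η, hη, hclu⟩ := hgap R' hR'
    obtain ⟨C, hC, T, hT, hcut⟩ := hCut X hUD (η / 4) (by positivity)
    obtain ⟨R, hR, n, xf, hxf, hrange, hthin⟩ :=
      hShell X hUD x₀ hx₀ (η / (4 * C)) (by positivity) T hT
    have hsub : Set.range xf ⊆ X := by
      rw [hrange]
      exact Set.inter_subset_left
    -- the window contains its centre, so it has at least one particle
    have hmem : x₀ ∈ Set.range xf := by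
      rw [hrange]
      exact ⟨hx₀, Metric.mem_closedBall_self hR⟩
    obtain ⟨i₀, -⟩ := hmem
    have hn1 : 1 ≤ n := Fin.pos i₀
    have hn : (1 : ℝ) ≤ n := by exact_mod_cast hn1
    -- removal test of the μGSC on the window
    have hrem := hGSC.removal hxf hsub
    -- the window inherits the holes of X: porosity gap
    have hpor : ∀ c : EuclideanSpace ℝ (Fin 3), ∃ z : EuclideanSpace ℝ (Fin 3),
        dist z c ≤ R' ∧ ∀ i : Fin n, r₁ < dist (xf i) z := by
      intro c
      obtain ⟨z, hz, hfar⟩ := hcon c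
      exact ⟨z, hz, fun i => hfar (xf i) (hsub ⟨i, rfl⟩)⟩
    have hlow := hclu n xf hxf hpor
    -- cut cost on the window
    have hfield := hcut x₀ R n xf hxf hrange
    -- thin shell: the boundary term is at most (η/4)·#W
    have hCne : C ≠ 0 := hC.ne'
    have hshellC : C * ((Finset.univ.filter fun i : Fin n => R - T < dist (xf i) x₀).card : ℝ) ≤
        η / 4 * n := by
      calc C * ((Finset.univ.filter fun i : Fin n => R - T < dist (xf i) x₀).card : ℝ)
          ≤ C * (η / (4 * C) * n) := mul_le_mul_of_nonneg_left hthin hC.le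
        _ = η / 4 * n := by field_simp
    have hηn : 0 < η * (n : ℝ) := mul_pos hη (by linarith)
    linarith

/-- **The crux BY NAME from the three stubs** (type literally the route decl; the only `sorry`s in
its cone are `stub_porosityGap`, `stub_cutCostShell`, `stub_thinShell`). -/
theorem MuGSCSolidBalls_skeleton : Summit.AtomisticToContinuum.Crystallization.Theses.GrandCanonicalSelection.MuGSCSolidBalls :=
  MuGSCSolidBalls_of stub_porosityGap stub_cutCostShell stub_thinShell

/-- Alias under the `<Crux>_proof` name looked up by `ledger skeleton check` (same term). -/
theorem MuGSCSolidBalls_proof : Summit.AtomisticToContinuum.Crystallization.Theses.GrandCanonicalSelection.MuGSCSolidBalls :=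
  MuGSCSolidBalls_skeleton

end Summit.AtomisticToContinuum.Crystallization.Cruxes.MuGSCSolidBalls.Birth
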